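import Literature.Algebra.Lie.ChevalleyEilenbergCasimirHomotopy
import Literature.NumberTheory.Automorphic.GKTensorCohomologySums
import HarnessLib

/-!
# Casimir operators and central elements on `(𝔤, K)`-cohomology; Wigner's lemma for quadratic
# Casimir operators: `H(C_V ⊗ 1) = H(1 ⊗ C_W)` on `H^q(𝔤, K; V ⊗ W)`

Topic `NumberTheory/Automorphic`; namespaces `Literature.NumberTheory.Automorphic.GKCasimir` and
`….GKTensor`. Definitions with bodies and theorems only; no named fact, no `sorry`. The
`(𝔤, K)`-side of the Casimir homotopy of `Literature.Algebra.Lie.ChevalleyEilenbergCasimirHomotopy`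
for the tree's `(𝔤, K)`-module data `(ρK, ρ𝔤)` on a complex space `V` of a real matrix group `G`
(`GKCohomology`: `gkCohomology G ρK ρ𝔤 had q = H^q(𝔤, K; V)`, `gkCohomologyMap`), and for tensor
products `V ⊗ W` (`GKModuleTensor`, `GKTensorCohomologySums`).

Let `(y_s, y'_s)_s` be a finite family in `𝔤 = G.lie` whose tensor `∑_s y_s ⊗ y'_s ∈ 𝔤 ⊗_ℝ 𝔤`
is `𝔤`-INVARIANT (`∑ [X, y_s] ⊗ y'_s + y_s ⊗ [X, y'_s] = 0`) and `Ad(K)`-INVARIANT — e.g. the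
canonical tensor `∑ᵢ bᵢ ⊗ bⁱ` of an `Ad`-invariant non-degenerate symmetric real bilinear form on
`𝔤` (`Literature.Algebra.Lie.sum_lie_basis_tmul_dualBasis_add`, `sum_map_basis_tmul_dualBasis`),
whose operator `C = ∑ ρ𝔤(bᵢ) ρ𝔤(bⁱ)` is the Casimir operator of the form [cite: Knapp2002, §V.4].

* `GKCasimir.op G ρ𝔤 y y' = C_V = ∑_s ρ𝔤(y_s) ρ𝔤(y'_s)`; `op_comm𝔤`, `op_commK` — it commutes with
  `𝔤` and `K`; **`GKCasimir.gkCohomologyMap_op_eq_zero`** — `H(C_V) = 0` on `H^q(𝔤, K; V)`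
  [cite: ChevalleyEilenberg1948, §24]; **`GKCasimir.gkCohomologyMap_central_eq_zero`** — a central
  `Ad(K)`-fixed `Z ∈ 𝔤` acts by zero on `H^q(𝔤, K; V)` [cite: BorelWallach2000, I §1.1 (5)].
* On `V ⊗ W` (diagonal `K`, Leibniz `𝔤`): `GKTensor.mixed = M = ∑_s ρ𝔤(y_s) ⊗ σ𝔤(y'_s)`,
  `sum_rTensor_mul_lie : ∑_s (ρ𝔤(y_s) ⊗ 1) X_{y'_s} = C_V ⊗ 1 + M`,
  `sum_lTensor_mul_lie : ∑_s (1 ⊗ σ𝔤(y_s)) X_{y'_s} = M' + 1 ⊗ C_W` (`M' = M` for a symmetric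
  tensor, `mixed_swap`); both sums are Casimir operators of the homotopy (`σ = ρ𝔤 ⊗ 1`,
  `σ = 1 ⊗ σ𝔤`: `sigmaLeft`, `sigmaRight`, equivariant by `lie_mul_rTensor_sub`,
  `lie_mul_lTensor_sub`) hence act by zero on `H^q(𝔤, K; V ⊗ W)`
  (`endoCohomologyHom_sum_rTensor_mul_lie_eq_zero`, `…lTensor…`);
* **`GKTensor.endoCohomologyHom_rTensor_op_eq_lTensor_op`** — `H(C_V ⊗ 1) = H(1 ⊗ C_W)` on
  `H^q(𝔤, K; V ⊗ W)`; **`GKTensor.casimir_scalar_eq_of_cohomology_ne_zero`** — if `C_V = c`,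
  `C_W = c'` are scalars and `H^q(𝔤, K; V ⊗ W) ≠ 0` then `c = c'`;
  **`GKTensor.central_scalar_add_eq_zero_of_cohomology_ne_zero`** — for `Z` central acting by `c`
  on `V` and `c'` on `W`, `H^q ≠ 0` forces `c + c' = 0`.

This is WIGNER'S LEMMA [cite: BorelWallach2000, I §4.1, Thm. 4.1; §5.3] for the part of the
centre of `U(𝔤)` generated by `𝔷(𝔤)` and the quadratic Casimir elements of invariant forms —
proved here by explicit cochain homotopies instead of `Ext`; for `𝔤𝔩₂` over a number field this
part is all of `Z(𝔤_ℂ)`, which gives the infinitesimal character of the cohomological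
representations (`H^q(𝔤, K_∞; π ⊗ E) ≠ 0 ⇒ χ_π = χ_{E^∨}`) used for the interior cohomology of
Bianchi manifolds [cite: Harder1987, §3.6].

## References

* A. Borel, N. Wallach, *Continuous cohomology, discrete subgroups, and representations of
  reductive groups*, 2nd ed. (2000), I §1.1 (5), §4.1 (Thm. 4.1), §5.1, §5.3. [BorelWallach2000]
* C. Chevalley, S. Eilenberg, Trans. AMS 63 (1948), §24. [ChevalleyEilenberg1948]
* A. W. Knapp, *Lie Groups Beyond an Introduction*, 2nd ed. (2002), §V.4. [Knapp2002]
* G. Harder, *Eisenstein cohomology of arithmetic groups. The case GL₂*, Invent. Math. 89 (1987),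
  §3.6. [Harder1987]
-/

noncomputable section

namespace Literature.NumberTheory.Automorphic

open TensorProduct Literature.Algebra.Lie

-- Mathlib idiom (as in `GKModules`): commutator bracket on `Module.End`
attribute [local instance 100] LieRing.ofAssociativeRing

variable {A : Type*} [NormedCommRing A] [NormedAlgebra ℝ A] [NormedAlgebra ℚ A] [CompleteSpace A]
  [StarRing A] [StarModule ℝ A] {N : Type*} [Fintype N] [DecidableEq N] (G : RealMatrixGroup A N)
  {V : Type*} [AddCommGroup V] [Module ℂ V]
  (ρK : Representation ℂ G.maximalCompact V) (ρ𝔤 : G.lie →ₗ⁅ℝ⁆ Module.End ℂ V)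
  (hV : ∀ (k : G.maximalCompact) (X : G.lie),
    ρK k ∘ₗ ρ𝔤 X ∘ₗ ρK k⁻¹ = ρ𝔤 (G.Ad (Subgroup.inclusion G.maximalCompact_le_carrier k) X))
  {ι : Type*} [Fintype ι] (y y' : ι → G.lie)

namespace GKCasimir

/-- **The Casimir-type operator `C = ∑_s ρ𝔤(y_s) ρ𝔤(y'_s)` of a finite family of pairs in `𝔤`**
acting on a complex space through `ρ𝔤` (for `∑ y_s ⊗ y'_s` the canonical tensor of an invariant
form: the Casimir operator of the form). [cite: Knapp2002, §V.4 (5.24)] -/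
def op : Module.End ℂ V := ∑ s, ρ𝔤 (y s) * ρ𝔤 (y' s)

omit [StarModule ℝ A] in
/-- Unfolding. [folklore] -/
theorem op_apply (v : V) : op G ρ𝔤 y y' v = ∑ s, ρ𝔤 (y s) (ρ𝔤 (y' s) v) := by
  simp [op]

/-- The real-bilinear map `(u, v) ↦ ρ𝔤(u) σ𝔤(v)` into complex-linear maps. [folklore] -/
def mulBilin {W : Type*} [AddCommGroup W] [Module ℂ W] (σ𝔤 : G.lie →ₗ⁅ℝ⁆ Module.End ℂ V) :
    G.lie →ₗ[ℝ] G.lie →ₗ[ℝ] Module.End ℂ V :=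
  LinearMap.mk₂ ℝ (fun u v => ρ𝔤 u * σ𝔤 v)
    (fun u u' v => by rw [map_add, add_mul])
    (fun c u v => by
      change ρ𝔤 (c • u) * σ𝔤 v = (c : ℂ) • (ρ𝔤 u * σ𝔤 v)
      rw [map_smul, ← smul_mul_assoc]; rfl)
    (fun u v v' => by rw [map_add, mul_add])
    (fun c u v => by
      change ρ𝔤 u * σ𝔤 (c • v) = (c : ℂ) • (ρ𝔤 u * σ𝔤 v)
      rw [map_smul, ← mul_smul_comm]; rfl)

omit [StarModule ℝ A] in
/-- Unfolding. [folklore] -/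
@[simp] theorem mulBilin_apply (σ𝔤 : G.lie →ₗ⁅ℝ⁆ Module.End ℂ V) (u v : G.lie) :
    mulBilin G ρ𝔤 (W := V) σ𝔤 u v = ρ𝔤 u * σ𝔤 v := rfl

omit [StarModule ℝ A] in
/-- **`C` commutes with `𝔤`** when the tensor `∑ y_s ⊗ y'_s` is `𝔤`-invariant.
[cite: Knapp2002, §V.4 Prop. 5.24] -/
theorem op_comm𝔤
    (hT : ∀ X : G.lie, ∑ s, (⁅X, y s⁆ ⊗ₜ[ℝ] y' s + y s ⊗ₜ[ℝ] ⁅X, y' s⁆) = (0 : G.lie ⊗[ℝ] G.lie))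
    (X : G.lie) : op G ρ𝔤 y y' ∘ₗ ρ𝔤 X = ρ𝔤 X ∘ₗ op G ρ𝔤 y y' := by
  have key := ChevalleyEilenberg.sum_bilin_eq_zero_of_tensor (y := y) (y' := y')
    (mulBilin G ρ𝔤 (W := V) ρ𝔤) (hT X)
  simp only [mulBilin_apply] at key
  have hcomm : ∀ u : G.lie, ρ𝔤 X * ρ𝔤 u = ρ𝔤 u * ρ𝔤 X + ρ𝔤 ⁅X, u⁆ := fun u => by
    rw [LieHom.map_lie, Ring.lie_def]; abel
  have h1 : ∀ s, ρ𝔤 X * (ρ𝔤 (y s) * ρ𝔤 (y' s)) =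
      ρ𝔤 (y s) * ρ𝔤 (y' s) * ρ𝔤 X + (ρ𝔤 ⁅X, y s⁆ * ρ𝔤 (y' s) + ρ𝔤 (y s) * ρ𝔤 ⁅X, y' s⁆) := by
    intro s
    rw [← mul_assoc, hcomm, add_mul, mul_assoc, hcomm, mul_add, ← mul_assoc]
    abel
  change op G ρ𝔤 y y' * ρ𝔤 X = ρ𝔤 X * op G ρ𝔤 y y'
  rw [op, Finset.mul_sum, Finset.sum_mul]
  simp only [h1, Finset.sum_add_distrib, key, add_zero]

omit [StarModule ℝ A] in
include hV in
/-- `ρK k ∘ ρ𝔤 X = ρ𝔤 (Ad k X) ∘ ρK k` (the compatibility axiom, rearranged). [folklore] -/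
theorem rep_mul_lie (k : G.maximalCompact) (X : G.lie) :
    ρK k * ρ𝔤 X = ρ𝔤 (G.Ad (Subgroup.inclusion G.maximalCompact_le_carrier k) X) * ρK k := by
  rw [← hV k X]
  change _ = ρK k * ρ𝔤 X * ρK k⁻¹ * ρK k
  rw [mul_assoc, ← map_mul, inv_mul_cancel, map_one, mul_one]

omit [StarModule ℝ A] in
include hV in
/-- **`C` commutes with `K`** when the tensor is `Ad(K)`-invariant. [cite: Knapp2002, §V.4] -/
theorem op_commK
    (hTK : ∀ k : G.maximalCompact,
      ∑ s, G.Ad (Subgroup.inclusion G.maximalCompact_le_carrier k) (y s) ⊗ₜ[ℝ]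
          G.Ad (Subgroup.inclusion G.maximalCompact_le_carrier k) (y' s) = ∑ s, y s ⊗ₜ[ℝ] y' s)
    (k : G.maximalCompact) : op G ρ𝔤 y y' ∘ₗ ρK k = ρK k ∘ₗ op G ρ𝔤 y y' := by
  have key := ChevalleyEilenberg.sum_bilin_eq_of_tensor_eq (y := y) (y' := y')
    (mulBilin G ρ𝔤 (W := V) ρ𝔤)
    (z := fun s => G.Ad (Subgroup.inclusion G.maximalCompact_le_carrier k) (y s))
    (z' := fun s => G.Ad (Subgroup.inclusion G.maximalCompact_le_carrier k) (y' s)) (hTK k)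
  simp only [mulBilin_apply] at key
  have h1 : ∀ s, ρK k * (ρ𝔤 (y s) * ρ𝔤 (y' s)) =
      ρ𝔤 (G.Ad (Subgroup.inclusion G.maximalCompact_le_carrier k) (y s)) *
        ρ𝔤 (G.Ad (Subgroup.inclusion G.maximalCompact_le_carrier k) (y' s)) * ρK k := by
    intro s
    rw [← mul_assoc, rep_mul_lie G ρK ρ𝔤 hV, mul_assoc, rep_mul_lie G ρK ρ𝔤 hV, ← mul_assoc]
  change op G ρ𝔤 y y' * ρK k = ρK k * op G ρ𝔤 y y'
  rw [op, Finset.mul_sum]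
  simp only [h1]
  rw [← Finset.sum_mul, key, Finset.sum_mul]

/-! ### `H(C) = 0` on `H^q(𝔤, K; V)` -/

/-- The action `ρ𝔤` on the carrier, as a real-linear map into real-linear endomorphisms (the `σ`
of the Casimir homotopy). [folklore] -/
def sigmaSelf : G.lie →ₗ[ℝ] Module.End ℝ (GKCarrier G ρ𝔤) :=
  (LieModule.toEnd ℝ G.lie (GKCarrier G ρ𝔤) : G.lie →ₗ⁅ℝ⁆ Module.End ℝ (GKCarrier G ρ𝔤)).toLinearMap

omit [StarModule ℝ A] in
/-- Equivariance of `σ = ρ`. [folklore] -/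
theorem sigmaSelf_equivariant (x u : G.lie) :
    LieModule.toEnd ℝ G.lie (GKCarrier G ρ𝔤) x * sigmaSelf G ρ𝔤 u -
        sigmaSelf G ρ𝔤 u * LieModule.toEnd ℝ G.lie (GKCarrier G ρ𝔤) x =
      sigmaSelf G ρ𝔤 ⁅x, u⁆ := by
  change LieModule.toEnd ℝ G.lie (GKCarrier G ρ𝔤) x * LieModule.toEnd ℝ G.lie (GKCarrier G ρ𝔤) u -
      LieModule.toEnd ℝ G.lie (GKCarrier G ρ𝔤) u * LieModule.toEnd ℝ G.lie (GKCarrier G ρ𝔤) x =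
    LieModule.toEnd ℝ G.lie (GKCarrier G ρ𝔤) ⁅x, u⁆
  rw [LieHom.map_lie, Ring.lie_def]

omit [StarModule ℝ A] in
/-- `K`-equivariance of `σ = ρ` for the pair action. [folklore] -/
theorem sigmaSelf_equivariantK (k : G.maximalCompact) (u : G.lie) :
    (gkPairAction G ρK ρ𝔤 hV).τ k ∘ₗ sigmaSelf G ρ𝔤 u =
      sigmaSelf G ρ𝔤 ((gkPairAction G ρK ρ𝔤 hV).σ k u) ∘ₗ (gkPairAction G ρK ρ𝔤 hV).τ k :=
  LinearMap.ext fun m => (gkPairAction G ρK ρ𝔤 hV).compat k u m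

/-- **The Casimir operator acts by zero on `H^q(𝔤, K; V)`** (Chevalley–Eilenberg's homotopy,
`Literature.Algebra.Lie.ChevalleyEilenbergCasimirHomotopy`).
[cite: ChevalleyEilenberg1948, §24] [cite: BorelWallach2000, I §5.1] -/
theorem gkCohomologyMap_op_eq_zero
    (hT : ∀ X : G.lie, ∑ s, (⁅X, y s⁆ ⊗ₜ[ℝ] y' s + y s ⊗ₜ[ℝ] ⁅X, y' s⁆) = (0 : G.lie ⊗[ℝ] G.lie))
    (hTK : ∀ k : G.maximalCompact,
      ∑ s, G.Ad (Subgroup.inclusion G.maximalCompact_le_carrier k) (y s) ⊗ₜ[ℝ]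
          G.Ad (Subgroup.inclusion G.maximalCompact_le_carrier k) (y' s) = ∑ s, y s ⊗ₜ[ℝ] y' s)
    (q : ℕ) (x : gkCohomology G ρK ρ𝔤 hV q) :
    gkCohomologyMap G ρK ρ𝔤 hV (op G ρ𝔤 y y') (op_comm𝔤 G ρ𝔤 y y' hT) (op_commK G ρK ρ𝔤 hV y y' hTK)
      q x = 0 := by
  rw [gkCohomologyMap_apply]
  have h0 := ChevalleyEilenberg.gKCohomologyMap_casimirEndo_eq_zero (σ := sigmaSelf G ρ𝔤)
    (y := y) (y' := y') G.kInLie (gkPairAction G ρK ρ𝔤 hV) (sigmaSelf_equivariant G ρ𝔤) hT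
    (sigmaSelf_equivariantK G ρK ρ𝔤 hV) hTK q x
  rw [ChevalleyEilenberg.gKCohomologyMap] at h0
  refine Eq.trans (ChevalleyEilenberg.Subcomplex.IsCochainMapTo.cohomologyMap_congr
    (ChevalleyEilenberg.Subcomplex.isCochainMapTo_gK_map _ _ _
      (GKCarrier.endo_comm G ρK ρ𝔤 hV (op G ρ𝔤 y y') (op_comm𝔤 G ρ𝔤 y y' hT)
        (op_commK G ρK ρ𝔤 hV y y' hTK)))
    (ChevalleyEilenberg.Subcomplex.isCochainMapTo_gK_map _ _ _
      (ChevalleyEilenberg.tau_comp_casimirEndo (gkPairAction G ρK ρ𝔤 hV)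
        (sigmaSelf_equivariant G ρ𝔤) hT (sigmaSelf_equivariantK G ρK ρ𝔤 hV) hTK))
    (fun q f _ => ?_) q x) h0
  ext v
  change op G ρ𝔤 y y' (f v) = ChevalleyEilenberg.casimirOp (sigmaSelf G ρ𝔤) y y' (f v)
  rw [op_apply, ChevalleyEilenberg.casimirOp_apply]
  rfl

/-! ### Central elements -/

omit [StarModule ℝ A] in
/-- A central `Z ∈ 𝔤` gives a `𝔤`-endomorphism `ρ𝔤 Z`. [folklore] -/
theorem lie_comm𝔤 {Z : G.lie} (hZ : ∀ X : G.lie, ⁅Z, X⁆ = 0) (X : G.lie) :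
    ρ𝔤 Z ∘ₗ ρ𝔤 X = ρ𝔤 X ∘ₗ ρ𝔤 Z := by
  change ρ𝔤 Z * ρ𝔤 X = ρ𝔤 X * ρ𝔤 Z
  have h := LieHom.map_lie ρ𝔤 Z X
  rw [hZ, map_zero, Ring.lie_def] at h
  exact (sub_eq_zero.mp h.symm)

omit [StarModule ℝ A] in
include hV in
/-- An `Ad(K)`-fixed `Z ∈ 𝔤` gives a `K`-endomorphism `ρ𝔤 Z`. [folklore] -/
theorem lie_commK {Z : G.lie}
    (hZK : ∀ k : G.maximalCompact, G.Ad (Subgroup.inclusion G.maximalCompact_le_carrier k) Z = Z)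
    (k : G.maximalCompact) : ρ𝔤 Z ∘ₗ ρK k = ρK k ∘ₗ ρ𝔤 Z := by
  change ρ𝔤 Z * ρK k = ρK k * ρ𝔤 Z
  rw [rep_mul_lie G ρK ρ𝔤 hV, hZK]

/-- **A central `Ad(K)`-fixed element of `𝔤` acts by zero on `H^q(𝔤, K; V)`** (Cartan's homotopy
formula). [cite: BorelWallach2000, I §1.1 (5)] -/
theorem gkCohomologyMap_central_eq_zero {Z : G.lie} (hZ : ∀ X : G.lie, ⁅Z, X⁆ = 0)
    (hZK : ∀ k : G.maximalCompact, G.Ad (Subgroup.inclusion G.maximalCompact_le_carrier k) Z = Z)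
    (q : ℕ) (x : gkCohomology G ρK ρ𝔤 hV q) :
    gkCohomologyMap G ρK ρ𝔤 hV (ρ𝔤 Z) (lie_comm𝔤 G ρ𝔤 hZ) (lie_commK G ρK ρ𝔤 hV hZK) q x = 0 := by
  rw [gkCohomologyMap_apply]
  have h0 := ChevalleyEilenberg.gKCohomologyMap_centralEndo_eq_zero G.kInLie
    (gkPairAction G ρK ρ𝔤 hV) (z := Z) hZ hZK q x
  rw [ChevalleyEilenberg.gKCohomologyMap] at h0
  refine Eq.trans (ChevalleyEilenberg.Subcomplex.IsCochainMapTo.cohomologyMap_congr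
    (ChevalleyEilenberg.Subcomplex.isCochainMapTo_gK_map _ _ _
      (GKCarrier.endo_comm G ρK ρ𝔤 hV (ρ𝔤 Z) (lie_comm𝔤 G ρ𝔤 hZ) (lie_commK G ρK ρ𝔤 hV hZK)))
    (ChevalleyEilenberg.Subcomplex.isCochainMapTo_gK_map _ _ _
      (ChevalleyEilenberg.tau_comp_centralEndo (gkPairAction G ρK ρ𝔤 hV) hZ hZK))
    (fun q f _ => ?_) q x) h0
  ext v
  rfl

end GKCasimir

/-! ### Tensor products: `H(C_V ⊗ 1) = H(1 ⊗ C_W)` -/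

namespace GKTensor

variable {W : Type*} [AddCommGroup W] [Module ℂ W]
  (σK : Representation ℂ G.maximalCompact W) (σ𝔤 : G.lie →ₗ⁅ℝ⁆ Module.End ℂ W)
  (hW : ∀ (k : G.maximalCompact) (X : G.lie),
    σK k ∘ₗ σ𝔤 X ∘ₗ σK k⁻¹ = σ𝔤 (G.Ad (Subgroup.inclusion G.maximalCompact_le_carrier k) X))

omit [StarModule ℝ A] in
/-- `1 ⊗ T` commutes with the Leibniz action when `T` commutes with `σ𝔤`. [folklore] -/
theorem lTensor_comm_lie (T : W →ₗ[ℂ] W) (hT𝔤 : ∀ X : G.lie, T ∘ₗ σ𝔤 X = σ𝔤 X ∘ₗ T)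
    (X : G.lie) :
    T.lTensor V ∘ₗ GKTensor.lie G ρ𝔤 σ𝔤 X = GKTensor.lie G ρ𝔤 σ𝔤 X ∘ₗ T.lTensor V := by
  refine TensorProduct.ext' fun v w => ?_
  simp only [LinearMap.coe_comp, Function.comp_apply, LinearMap.lTensor_tmul,
    GKTensor.lie_apply_tmul, map_add]
  rw [← LinearMap.comp_apply (f := T), hT𝔤 X, LinearMap.comp_apply]

omit [StarModule ℝ A] in
/-- `1 ⊗ T` commutes with the diagonal `K`-action when `T` commutes with `σK`. [folklore] -/
theorem lTensor_comm_tprod (T : W →ₗ[ℂ] W)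
    (hTK : ∀ k : G.maximalCompact, T ∘ₗ σK k = σK k ∘ₗ T) (k : G.maximalCompact) :
    T.lTensor V ∘ₗ ρK.tprod σK k = ρK.tprod σK k ∘ₗ T.lTensor V := by
  refine TensorProduct.ext' fun v w => ?_
  simp only [LinearMap.coe_comp, Function.comp_apply, LinearMap.lTensor_tmul,
    Representation.tprod_apply, TensorProduct.map_tmul]
  rw [← LinearMap.comp_apply (f := T), hTK k, LinearMap.comp_apply]

/-- **The mixed operator `M = ∑_s ρ𝔤(y_s) ⊗ σ𝔤(y'_s)` on `V ⊗ W`.** [folklore] -/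
def mixed : Module.End ℂ (V ⊗[ℂ] W) := ∑ s, TensorProduct.map (ρ𝔤 (y s)) (σ𝔤 (y' s))

/-- The real-bilinear map `(u, v) ↦ ρ𝔤(u) ⊗ σ𝔤(v)`. [folklore] -/
def mapBilin : G.lie →ₗ[ℝ] G.lie →ₗ[ℝ] Module.End ℂ (V ⊗[ℂ] W) :=
  LinearMap.mk₂ ℝ (fun u v => TensorProduct.map (ρ𝔤 u) (σ𝔤 v))
    (fun u u' v => by rw [map_add, TensorProduct.map_add_left])
    (fun c u v => by
      change TensorProduct.map (ρ𝔤 (c • u)) (σ𝔤 v) = (c : ℂ) • TensorProduct.map (ρ𝔤 u) (σ𝔤 v)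
      rw [map_smul, ← TensorProduct.map_smul_left]; rfl)
    (fun u v v' => by rw [map_add, TensorProduct.map_add_right])
    (fun c u v => by
      change TensorProduct.map (ρ𝔤 u) (σ𝔤 (c • v)) = (c : ℂ) • TensorProduct.map (ρ𝔤 u) (σ𝔤 v)
      rw [map_smul, ← TensorProduct.map_smul_right]; rfl)

omit [StarModule ℝ A] in
/-- Unfolding. [folklore] -/
@[simp] theorem mapBilin_apply (u v : G.lie) :
    mapBilin G ρ𝔤 σ𝔤 u v = TensorProduct.map (ρ𝔤 u) (σ𝔤 v) := rfl

omit [StarModule ℝ A] in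
/-- For a symmetric tensor the mixed operator is symmetric in the two families. [folklore] -/
theorem mixed_swap (hTs : ∑ s, y' s ⊗ₜ[ℝ] y s = ∑ s, y s ⊗ₜ[ℝ] y' s) :
    (∑ s, TensorProduct.map (ρ𝔤 (y' s)) (σ𝔤 (y s))) = mixed G ρ𝔤 y y' σ𝔤 := by
  have key := ChevalleyEilenberg.sum_bilin_eq_of_tensor_eq (y := y) (y' := y')
    (mapBilin G ρ𝔤 σ𝔤) (z := y') (z' := y) hTs
  simp only [mapBilin_apply] at key
  rw [mixed]
  exact key

omit [StarModule ℝ A] in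
/-- `∑_s (ρ𝔤(y_s) ⊗ 1) ∘ X_{y'_s} = C_V ⊗ 1 + M` on `V ⊗ W` (`X_y = ρ𝔤 y ⊗ 1 + 1 ⊗ σ𝔤 y`).
[folklore] -/
theorem sum_rTensor_mul_lie :
    (∑ s, (ρ𝔤 (y s)).rTensor W * GKTensor.lie G ρ𝔤 σ𝔤 (y' s)) =
      (GKCasimir.op G ρ𝔤 y y').rTensor W + mixed G ρ𝔤 y y' σ𝔤 := by
  have h1 : ∀ s, (ρ𝔤 (y s)).rTensor W * GKTensor.lie G ρ𝔤 σ𝔤 (y' s) =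
      (ρ𝔤 (y s) * ρ𝔤 (y' s)).rTensor W + TensorProduct.map (ρ𝔤 (y s)) (σ𝔤 (y' s)) := by
    intro s
    rw [GKTensor.lie_apply, mul_add, ← LinearMap.rTensor_mul]
    congr 1
    rw [Module.End.mul_eq_comp, LinearMap.rTensor_comp_lTensor]
  simp only [h1, Finset.sum_add_distrib, GKCasimir.op, mixed]
  congr 1
  change (∑ s, LinearMap.rTensorHom W (ρ𝔤 (y s) * ρ𝔤 (y' s))) =
    LinearMap.rTensorHom W (∑ s, ρ𝔤 (y s) * ρ𝔤 (y' s))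
  rw [map_sum]

omit [StarModule ℝ A] in
/-- `∑_s (1 ⊗ σ𝔤(y_s)) ∘ X_{y'_s} = M' + 1 ⊗ C_W` on `V ⊗ W`. [folklore] -/
theorem sum_lTensor_mul_lie :
    (∑ s, (σ𝔤 (y s)).lTensor V * GKTensor.lie G ρ𝔤 σ𝔤 (y' s)) =
      (∑ s, TensorProduct.map (ρ𝔤 (y' s)) (σ𝔤 (y s))) + (GKCasimir.op G σ𝔤 y y').lTensor V := by
  have h1 : ∀ s, (σ𝔤 (y s)).lTensor V * GKTensor.lie G ρ𝔤 σ𝔤 (y' s) =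
      TensorProduct.map (ρ𝔤 (y' s)) (σ𝔤 (y s)) + (σ𝔤 (y s) * σ𝔤 (y' s)).lTensor V := by
    intro s
    rw [GKTensor.lie_apply, mul_add, ← LinearMap.lTensor_mul]
    congr 1
    rw [Module.End.mul_eq_comp, LinearMap.lTensor_comp_rTensor]
  simp only [h1, Finset.sum_add_distrib, GKCasimir.op]
  congr 1
  change (∑ s, LinearMap.lTensorHom V (σ𝔤 (y s) * σ𝔤 (y' s))) =
    LinearMap.lTensorHom V (∑ s, σ𝔤 (y s) * σ𝔤 (y' s))
  rw [map_sum]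

/-! #### The two Casimir homotopies on `V ⊗ W` -/

/-- `σ₁(u) = ρ𝔤(u) ⊗ 1` as a real-linear map into real-linear endomorphisms of the carrier.
[folklore] -/
def sigmaLeft : G.lie →ₗ[ℝ] Module.End ℝ (GKCarrier G (GKTensor.lie G ρ𝔤 σ𝔤)) where
  toFun u := ((ρ𝔤 u).rTensor W).restrictScalars ℝ
  map_add' u u' := by
    ext m
    change ((ρ𝔤 (u + u')).rTensor W) m = ((ρ𝔤 u).rTensor W) m + ((ρ𝔤 u').rTensor W) m
    rw [map_add, LinearMap.rTensor_add, LinearMap.add_apply]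
  map_smul' c u := by
    ext m
    change ((ρ𝔤 (c • u)).rTensor W) m = (c : ℂ) • ((ρ𝔤 u).rTensor W) m
    have h : ρ𝔤 (c • u) = (c : ℂ) • ρ𝔤 u := by rw [map_smul]; rfl
    rw [h, LinearMap.rTensor_smul, LinearMap.smul_apply]

/-- `σ₂(u) = 1 ⊗ σ𝔤(u)`. [folklore] -/
def sigmaRight : G.lie →ₗ[ℝ] Module.End ℝ (GKCarrier G (GKTensor.lie G ρ𝔤 σ𝔤)) where
  toFun u := ((σ𝔤 u).lTensor V).restrictScalars ℝ
  map_add' u u' := by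
    ext m
    change ((σ𝔤 (u + u')).lTensor V) m = ((σ𝔤 u).lTensor V) m + ((σ𝔤 u').lTensor V) m
    rw [map_add, LinearMap.lTensor_add, LinearMap.add_apply]
  map_smul' c u := by
    ext m
    change ((σ𝔤 (c • u)).lTensor V) m = (c : ℂ) • ((σ𝔤 u).lTensor V) m
    have h : σ𝔤 (c • u) = (c : ℂ) • σ𝔤 u := by rw [map_smul]; rfl
    rw [h, LinearMap.lTensor_smul, LinearMap.smul_apply]

omit [StarModule ℝ A] in
/-- `[X, ρ𝔤(u) ⊗ 1] = ρ𝔤([X, u]) ⊗ 1` on `V ⊗ W`. [folklore] -/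
theorem lie_mul_rTensor_sub (X u : G.lie) :
    GKTensor.lie G ρ𝔤 σ𝔤 X * (ρ𝔤 u).rTensor W - (ρ𝔤 u).rTensor W * GKTensor.lie G ρ𝔤 σ𝔤 X =
      (ρ𝔤 ⁅X, u⁆).rTensor W := by
  have hc : (σ𝔤 X).lTensor V * (ρ𝔤 u).rTensor W = (ρ𝔤 u).rTensor W * (σ𝔤 X).lTensor V := by
    rw [Module.End.mul_eq_comp, Module.End.mul_eq_comp, LinearMap.rTensor_comp_lTensor,
      LinearMap.lTensor_comp_rTensor]
  rw [GKTensor.lie_apply, add_mul, mul_add, hc, LieHom.map_lie, Ring.lie_def,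
    LinearMap.rTensor_sub, LinearMap.rTensor_mul, LinearMap.rTensor_mul]
  abel

omit [StarModule ℝ A] in
/-- `[X, 1 ⊗ σ𝔤(u)] = 1 ⊗ σ𝔤([X, u])` on `V ⊗ W`. [folklore] -/
theorem lie_mul_lTensor_sub (X u : G.lie) :
    GKTensor.lie G ρ𝔤 σ𝔤 X * (σ𝔤 u).lTensor V - (σ𝔤 u).lTensor V * GKTensor.lie G ρ𝔤 σ𝔤 X =
      (σ𝔤 ⁅X, u⁆).lTensor V := by
  have hc : (ρ𝔤 X).rTensor W * (σ𝔤 u).lTensor V = (σ𝔤 u).lTensor V * (ρ𝔤 X).rTensor W := by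
    rw [Module.End.mul_eq_comp, Module.End.mul_eq_comp, LinearMap.rTensor_comp_lTensor,
      LinearMap.lTensor_comp_rTensor]
  rw [GKTensor.lie_apply, add_mul, mul_add, hc, LieHom.map_lie, Ring.lie_def,
    LinearMap.lTensor_sub, LinearMap.lTensor_mul, LinearMap.lTensor_mul]
  abel

omit [StarModule ℝ A] in
/-- Equivariance of `σ₁`. [folklore] -/
theorem sigmaLeft_equivariant (x u : G.lie) :
    LieModule.toEnd ℝ G.lie (GKCarrier G (GKTensor.lie G ρ𝔤 σ𝔤)) x * sigmaLeft G ρ𝔤 σ𝔤 u -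
        sigmaLeft G ρ𝔤 σ𝔤 u * LieModule.toEnd ℝ G.lie (GKCarrier G (GKTensor.lie G ρ𝔤 σ𝔤)) x =
      sigmaLeft G ρ𝔤 σ𝔤 ⁅x, u⁆ := by
  ext m
  exact LinearMap.congr_fun (lie_mul_rTensor_sub G ρ𝔤 σ𝔤 x u) m

omit [StarModule ℝ A] in
/-- Equivariance of `σ₂`. [folklore] -/
theorem sigmaRight_equivariant (x u : G.lie) :
    LieModule.toEnd ℝ G.lie (GKCarrier G (GKTensor.lie G ρ𝔤 σ𝔤)) x * sigmaRight G ρ𝔤 σ𝔤 u -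
        sigmaRight G ρ𝔤 σ𝔤 u * LieModule.toEnd ℝ G.lie (GKCarrier G (GKTensor.lie G ρ𝔤 σ𝔤)) x =
      sigmaRight G ρ𝔤 σ𝔤 ⁅x, u⁆ := by
  ext m
  exact LinearMap.congr_fun (lie_mul_lTensor_sub G ρ𝔤 σ𝔤 x u) m

omit [StarModule ℝ A] in
/-- `K`-equivariance of `σ₁`. [folklore] -/
theorem sigmaLeft_equivariantK (k : G.maximalCompact) (u : G.lie) :
    (gkPairAction G (ρK.tprod σK) (GKTensor.lie G ρ𝔤 σ𝔤)
          (GKTensor.ad_compat G ρK ρ𝔤 σK σ𝔤 hV hW)).τ k ∘ₗ sigmaLeft G ρ𝔤 σ𝔤 u =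
      sigmaLeft G ρ𝔤 σ𝔤 ((gkPairAction G (ρK.tprod σK) (GKTensor.lie G ρ𝔤 σ𝔤)
          (GKTensor.ad_compat G ρK ρ𝔤 σK σ𝔤 hV hW)).σ k u) ∘ₗ
        (gkPairAction G (ρK.tprod σK) (GKTensor.lie G ρ𝔤 σ𝔤)
          (GKTensor.ad_compat G ρK ρ𝔤 σK σ𝔤 hV hW)).τ k := by
  refine LinearMap.ext fun m => ?_
  change ρK.tprod σK k ((ρ𝔤 u).rTensor W m) =
    (ρ𝔤 (G.Ad (Subgroup.inclusion G.maximalCompact_le_carrier k) u)).rTensor W (ρK.tprod σK k m)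
  rw [← LinearMap.comp_apply, ← LinearMap.comp_apply (g := ρK.tprod σK k)]
  congr 1
  rw [Representation.tprod_apply, LinearMap.rTensor, LinearMap.rTensor, ← TensorProduct.map_comp,
    ← TensorProduct.map_comp, LinearMap.comp_id, LinearMap.id_comp]
  congr 1
  exact GKCasimir.rep_mul_lie G ρK ρ𝔤 hV k u

omit [StarModule ℝ A] in
/-- `K`-equivariance of `σ₂`. [folklore] -/
theorem sigmaRight_equivariantK (k : G.maximalCompact) (u : G.lie) :
    (gkPairAction G (ρK.tprod σK) (GKTensor.lie G ρ𝔤 σ𝔤)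
          (GKTensor.ad_compat G ρK ρ𝔤 σK σ𝔤 hV hW)).τ k ∘ₗ sigmaRight G ρ𝔤 σ𝔤 u =
      sigmaRight G ρ𝔤 σ𝔤 ((gkPairAction G (ρK.tprod σK) (GKTensor.lie G ρ𝔤 σ𝔤)
          (GKTensor.ad_compat G ρK ρ𝔤 σK σ𝔤 hV hW)).σ k u) ∘ₗ
        (gkPairAction G (ρK.tprod σK) (GKTensor.lie G ρ𝔤 σ𝔤)
          (GKTensor.ad_compat G ρK ρ𝔤 σK σ𝔤 hV hW)).τ k := by
  refine LinearMap.ext fun m => ?_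
  change ρK.tprod σK k ((σ𝔤 u).lTensor V m) =
    (σ𝔤 (G.Ad (Subgroup.inclusion G.maximalCompact_le_carrier k) u)).lTensor V (ρK.tprod σK k m)
  rw [← LinearMap.comp_apply, ← LinearMap.comp_apply (g := ρK.tprod σK k)]
  congr 1
  rw [Representation.tprod_apply, LinearMap.lTensor, LinearMap.lTensor, ← TensorProduct.map_comp,
    ← TensorProduct.map_comp, LinearMap.comp_id, LinearMap.id_comp]
  congr 1
  exact GKCasimir.rep_mul_lie G σK σ𝔤 hW k u

/-- `H` of a `(𝔤, K)`-endomorphism of `V ⊗ W` (abbreviation). [folklore] -/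
abbrev endoCohomologyHom (T : V ⊗[ℂ] W →ₗ[ℂ] V ⊗[ℂ] W)
    (hT𝔤 : ∀ X : G.lie, T ∘ₗ GKTensor.lie G ρ𝔤 σ𝔤 X = GKTensor.lie G ρ𝔤 σ𝔤 X ∘ₗ T)
    (hTK : ∀ k : G.maximalCompact, T ∘ₗ ρK.tprod σK k = ρK.tprod σK k ∘ₗ T) (q : ℕ) :
    GKTensor.cohomology G ρK ρ𝔤 σK σ𝔤 hV hW q →ₗ[ℂ] GKTensor.cohomology G ρK ρ𝔤 σK σ𝔤 hV hW q :=
  gkCohomologyMap G (ρK.tprod σK) (GKTensor.lie G ρ𝔤 σ𝔤) (GKTensor.ad_compat G ρK ρ𝔤 σK σ𝔤 hV hW)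
    T hT𝔤 hTK q

/-- **`H(∑_s (ρ𝔤(y_s) ⊗ 1) X_{y'_s}) = 0` on `H^q(𝔤, K; V ⊗ W)`** (Casimir homotopy with
`σ = ρ𝔤 ⊗ 1`). [cite: ChevalleyEilenberg1948, §24] [cite: BorelWallach2000, I §4.1] -/
theorem endoCohomologyHom_sum_rTensor_mul_lie_eq_zero
    (hT : ∀ X : G.lie, ∑ s, (⁅X, y s⁆ ⊗ₜ[ℝ] y' s + y s ⊗ₜ[ℝ] ⁅X, y' s⁆) = (0 : G.lie ⊗[ℝ] G.lie))
    (hTK : ∀ k : G.maximalCompact,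
      ∑ s, G.Ad (Subgroup.inclusion G.maximalCompact_le_carrier k) (y s) ⊗ₜ[ℝ]
          G.Ad (Subgroup.inclusion G.maximalCompact_le_carrier k) (y' s) = ∑ s, y s ⊗ₜ[ℝ] y' s)
    (h𝔤) (hK) (q : ℕ) (x : GKTensor.cohomology G ρK ρ𝔤 σK σ𝔤 hV hW q) :
    endoCohomologyHom G ρK ρ𝔤 hV σK σ𝔤 hW
      (∑ s, (ρ𝔤 (y s)).rTensor W * GKTensor.lie G ρ𝔤 σ𝔤 (y' s)) h𝔤 hK q x = 0 := by
  rw [endoCohomologyHom, gkCohomologyMap_apply]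
  have h0 := ChevalleyEilenberg.gKCohomologyMap_casimirEndo_eq_zero (σ := sigmaLeft G ρ𝔤 σ𝔤)
    (y := y) (y' := y') G.kInLie
    (gkPairAction G (ρK.tprod σK) (GKTensor.lie G ρ𝔤 σ𝔤) (GKTensor.ad_compat G ρK ρ𝔤 σK σ𝔤 hV hW))
    (sigmaLeft_equivariant G ρ𝔤 σ𝔤) hT (sigmaLeft_equivariantK G ρK ρ𝔤 hV σK σ𝔤 hW) hTK q x
  rw [ChevalleyEilenberg.gKCohomologyMap] at h0
  refine Eq.trans (ChevalleyEilenberg.Subcomplex.IsCochainMapTo.cohomologyMap_congr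
    (ChevalleyEilenberg.Subcomplex.isCochainMapTo_gK_map _ _ _
      (GKCarrier.endo_comm G (ρK.tprod σK) (GKTensor.lie G ρ𝔤 σ𝔤)
        (GKTensor.ad_compat G ρK ρ𝔤 σK σ𝔤 hV hW) _ h𝔤 hK))
    (ChevalleyEilenberg.Subcomplex.isCochainMapTo_gK_map _ _ _
      (ChevalleyEilenberg.tau_comp_casimirEndo
        (gkPairAction G (ρK.tprod σK) (GKTensor.lie G ρ𝔤 σ𝔤) (GKTensor.ad_compat G ρK ρ𝔤 σK σ𝔤 hV hW))
        (sigmaLeft_equivariant G ρ𝔤 σ𝔤) hT (sigmaLeft_equivariantK G ρK ρ𝔤 hV σK σ𝔤 hW) hTK))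
    (fun q f _ => ?_) q x) h0
  ext v
  change (∑ s, (ρ𝔤 (y s)).rTensor W * GKTensor.lie G ρ𝔤 σ𝔤 (y' s)) (f v) =
    ChevalleyEilenberg.casimirOp (sigmaLeft G ρ𝔤 σ𝔤) y y' (f v)
  rw [ChevalleyEilenberg.casimirOp_apply, LinearMap.sum_apply]
  rfl

/-- **`H(∑_s (1 ⊗ σ𝔤(y_s)) X_{y'_s}) = 0` on `H^q(𝔤, K; V ⊗ W)`** (Casimir homotopy with
`σ = 1 ⊗ σ𝔤`). [cite: ChevalleyEilenberg1948, §24] [cite: BorelWallach2000, I §4.1] -/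
theorem endoCohomologyHom_sum_lTensor_mul_lie_eq_zero
    (hT : ∀ X : G.lie, ∑ s, (⁅X, y s⁆ ⊗ₜ[ℝ] y' s + y s ⊗ₜ[ℝ] ⁅X, y' s⁆) = (0 : G.lie ⊗[ℝ] G.lie))
    (hTK : ∀ k : G.maximalCompact,
      ∑ s, G.Ad (Subgroup.inclusion G.maximalCompact_le_carrier k) (y s) ⊗ₜ[ℝ]
          G.Ad (Subgroup.inclusion G.maximalCompact_le_carrier k) (y' s) = ∑ s, y s ⊗ₜ[ℝ] y' s)
    (h𝔤) (hK) (q : ℕ) (x : GKTensor.cohomology G ρK ρ𝔤 σK σ𝔤 hV hW q) :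
    endoCohomologyHom G ρK ρ𝔤 hV σK σ𝔤 hW
      (∑ s, (σ𝔤 (y s)).lTensor V * GKTensor.lie G ρ𝔤 σ𝔤 (y' s)) h𝔤 hK q x = 0 := by
  rw [endoCohomologyHom, gkCohomologyMap_apply]
  have h0 := ChevalleyEilenberg.gKCohomologyMap_casimirEndo_eq_zero (σ := sigmaRight G ρ𝔤 σ𝔤)
    (y := y) (y' := y') G.kInLie
    (gkPairAction G (ρK.tprod σK) (GKTensor.lie G ρ𝔤 σ𝔤) (GKTensor.ad_compat G ρK ρ𝔤 σK σ𝔤 hV hW))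
    (sigmaRight_equivariant G ρ𝔤 σ𝔤) hT (sigmaRight_equivariantK G ρK ρ𝔤 hV σK σ𝔤 hW) hTK q x
  rw [ChevalleyEilenberg.gKCohomologyMap] at h0
  refine Eq.trans (ChevalleyEilenberg.Subcomplex.IsCochainMapTo.cohomologyMap_congr
    (ChevalleyEilenberg.Subcomplex.isCochainMapTo_gK_map _ _ _
      (GKCarrier.endo_comm G (ρK.tprod σK) (GKTensor.lie G ρ𝔤 σ𝔤)
        (GKTensor.ad_compat G ρK ρ𝔤 σK σ𝔤 hV hW) _ h𝔤 hK))
    (ChevalleyEilenberg.Subcomplex.isCochainMapTo_gK_map _ _ _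
      (ChevalleyEilenberg.tau_comp_casimirEndo
        (gkPairAction G (ρK.tprod σK) (GKTensor.lie G ρ𝔤 σ𝔤) (GKTensor.ad_compat G ρK ρ𝔤 σK σ𝔤 hV hW))
        (sigmaRight_equivariant G ρ𝔤 σ𝔤) hT (sigmaRight_equivariantK G ρK ρ𝔤 hV σK σ𝔤 hW) hTK))
    (fun q f _ => ?_) q x) h0
  ext v
  change (∑ s, (σ𝔤 (y s)).lTensor V * GKTensor.lie G ρ𝔤 σ𝔤 (y' s)) (f v) =
    ChevalleyEilenberg.casimirOp (sigmaRight G ρ𝔤 σ𝔤) y y' (f v)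
  rw [ChevalleyEilenberg.casimirOp_apply, LinearMap.sum_apply]
  rfl


/-! #### Commutation of the two operators; `H(C_V ⊗ 1) = H(1 ⊗ C_W)` -/

omit [StarModule ℝ A] in
/-- `T₁ = ∑_s (ρ𝔤(y_s) ⊗ 1) X_{y'_s}` commutes with `𝔤`. [folklore] -/
theorem sum_rTensor_mul_lie_comm𝔤
    (hT : ∀ X : G.lie, ∑ s, (⁅X, y s⁆ ⊗ₜ[ℝ] y' s + y s ⊗ₜ[ℝ] ⁅X, y' s⁆) = (0 : G.lie ⊗[ℝ] G.lie))
    (X : G.lie) :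
    (∑ s, (ρ𝔤 (y s)).rTensor W * GKTensor.lie G ρ𝔤 σ𝔤 (y' s)) ∘ₗ GKTensor.lie G ρ𝔤 σ𝔤 X =
      GKTensor.lie G ρ𝔤 σ𝔤 X ∘ₗ (∑ s, (ρ𝔤 (y s)).rTensor W * GKTensor.lie G ρ𝔤 σ𝔤 (y' s)) := by
  refine LinearMap.ext fun m => ?_
  have h := LinearMap.congr_fun (ChevalleyEilenberg.toEnd_mul_casimirOp (σ := sigmaLeft G ρ𝔤 σ𝔤)
    (y := y) (y' := y') (sigmaLeft_equivariant G ρ𝔤 σ𝔤) (hT X)) m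
  have e : ∀ m, ChevalleyEilenberg.casimirOp (sigmaLeft G ρ𝔤 σ𝔤) y y' m =
      (∑ s, (ρ𝔤 (y s)).rTensor W * GKTensor.lie G ρ𝔤 σ𝔤 (y' s)) m := fun m => by
    rw [ChevalleyEilenberg.casimirOp_apply, LinearMap.sum_apply]; rfl
  simp only [Module.End.mul_apply, LieModule.toEnd_apply_apply, e] at h
  exact h.symm

omit [StarModule ℝ A] in
include hV hW in
/-- `T₁` commutes with `K`. [folklore] -/
theorem sum_rTensor_mul_lie_commK
    (hTK : ∀ k : G.maximalCompact,
      ∑ s, G.Ad (Subgroup.inclusion G.maximalCompact_le_carrier k) (y s) ⊗ₜ[ℝ]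
          G.Ad (Subgroup.inclusion G.maximalCompact_le_carrier k) (y' s) = ∑ s, y s ⊗ₜ[ℝ] y' s)
    (k : G.maximalCompact) :
    (∑ s, (ρ𝔤 (y s)).rTensor W * GKTensor.lie G ρ𝔤 σ𝔤 (y' s)) ∘ₗ ρK.tprod σK k =
      ρK.tprod σK k ∘ₗ (∑ s, (ρ𝔤 (y s)).rTensor W * GKTensor.lie G ρ𝔤 σ𝔤 (y' s)) := by
  refine LinearMap.ext fun m => ?_
  have h := LinearMap.congr_fun (ChevalleyEilenberg.tau_comp_casimirOp (σ := sigmaLeft G ρ𝔤 σ𝔤)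
    (y := y) (y' := y')
    (gkPairAction G (ρK.tprod σK) (GKTensor.lie G ρ𝔤 σ𝔤) (GKTensor.ad_compat G ρK ρ𝔤 σK σ𝔤 hV hW))
    (sigmaLeft_equivariantK G ρK ρ𝔤 hV σK σ𝔤 hW) (hTK k)) m
  have e : ∀ m, ChevalleyEilenberg.casimirOp (sigmaLeft G ρ𝔤 σ𝔤) y y' m =
      (∑ s, (ρ𝔤 (y s)).rTensor W * GKTensor.lie G ρ𝔤 σ𝔤 (y' s)) m := fun m => by
    rw [ChevalleyEilenberg.casimirOp_apply, LinearMap.sum_apply]; rfl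
  simp only [LinearMap.comp_apply, e] at h
  exact h.symm

omit [StarModule ℝ A] in
/-- `T₂ = ∑_s (1 ⊗ σ𝔤(y_s)) X_{y'_s}` commutes with `𝔤`. [folklore] -/
theorem sum_lTensor_mul_lie_comm𝔤
    (hT : ∀ X : G.lie, ∑ s, (⁅X, y s⁆ ⊗ₜ[ℝ] y' s + y s ⊗ₜ[ℝ] ⁅X, y' s⁆) = (0 : G.lie ⊗[ℝ] G.lie))
    (X : G.lie) :
    (∑ s, (σ𝔤 (y s)).lTensor V * GKTensor.lie G ρ𝔤 σ𝔤 (y' s)) ∘ₗ GKTensor.lie G ρ𝔤 σ𝔤 X =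
      GKTensor.lie G ρ𝔤 σ𝔤 X ∘ₗ (∑ s, (σ𝔤 (y s)).lTensor V * GKTensor.lie G ρ𝔤 σ𝔤 (y' s)) := by
  refine LinearMap.ext fun m => ?_
  have h := LinearMap.congr_fun (ChevalleyEilenberg.toEnd_mul_casimirOp (σ := sigmaRight G ρ𝔤 σ𝔤)
    (y := y) (y' := y') (sigmaRight_equivariant G ρ𝔤 σ𝔤) (hT X)) m
  have e : ∀ m, ChevalleyEilenberg.casimirOp (sigmaRight G ρ𝔤 σ𝔤) y y' m =
      (∑ s, (σ𝔤 (y s)).lTensor V * GKTensor.lie G ρ𝔤 σ𝔤 (y' s)) m := fun m => by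
    rw [ChevalleyEilenberg.casimirOp_apply, LinearMap.sum_apply]; rfl
  simp only [Module.End.mul_apply, LieModule.toEnd_apply_apply, e] at h
  exact h.symm

omit [StarModule ℝ A] in
include hV hW in
/-- `T₂` commutes with `K`. [folklore] -/
theorem sum_lTensor_mul_lie_commK
    (hTK : ∀ k : G.maximalCompact,
      ∑ s, G.Ad (Subgroup.inclusion G.maximalCompact_le_carrier k) (y s) ⊗ₜ[ℝ]
          G.Ad (Subgroup.inclusion G.maximalCompact_le_carrier k) (y' s) = ∑ s, y s ⊗ₜ[ℝ] y' s)
    (k : G.maximalCompact) :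
    (∑ s, (σ𝔤 (y s)).lTensor V * GKTensor.lie G ρ𝔤 σ𝔤 (y' s)) ∘ₗ ρK.tprod σK k =
      ρK.tprod σK k ∘ₗ (∑ s, (σ𝔤 (y s)).lTensor V * GKTensor.lie G ρ𝔤 σ𝔤 (y' s)) := by
  refine LinearMap.ext fun m => ?_
  have h := LinearMap.congr_fun (ChevalleyEilenberg.tau_comp_casimirOp (σ := sigmaRight G ρ𝔤 σ𝔤)
    (y := y) (y' := y')
    (gkPairAction G (ρK.tprod σK) (GKTensor.lie G ρ𝔤 σ𝔤) (GKTensor.ad_compat G ρK ρ𝔤 σK σ𝔤 hV hW))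
    (sigmaRight_equivariantK G ρK ρ𝔤 hV σK σ𝔤 hW) (hTK k)) m
  have e : ∀ m, ChevalleyEilenberg.casimirOp (sigmaRight G ρ𝔤 σ𝔤) y y' m =
      (∑ s, (σ𝔤 (y s)).lTensor V * GKTensor.lie G ρ𝔤 σ𝔤 (y' s)) m := fun m => by
    rw [ChevalleyEilenberg.casimirOp_apply, LinearMap.sum_apply]; rfl
  simp only [LinearMap.comp_apply, e] at h
  exact h.symm

omit [StarModule ℝ A] in
/-- Commutation with `𝔤` passes to differences. [folklore] -/
theorem sub_comm𝔤 {T R : V ⊗[ℂ] W →ₗ[ℂ] V ⊗[ℂ] W}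
    (hT : ∀ X : G.lie, T ∘ₗ GKTensor.lie G ρ𝔤 σ𝔤 X = GKTensor.lie G ρ𝔤 σ𝔤 X ∘ₗ T)
    (hR : ∀ X : G.lie, R ∘ₗ GKTensor.lie G ρ𝔤 σ𝔤 X = GKTensor.lie G ρ𝔤 σ𝔤 X ∘ₗ R) (X : G.lie) :
    (T - R) ∘ₗ GKTensor.lie G ρ𝔤 σ𝔤 X = GKTensor.lie G ρ𝔤 σ𝔤 X ∘ₗ (T - R) := by
  rw [LinearMap.sub_comp, LinearMap.comp_sub, hT X, hR X]

omit [StarModule ℝ A] in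
/-- Commutation with `K` passes to differences. [folklore] -/
theorem sub_commK {T R : V ⊗[ℂ] W →ₗ[ℂ] V ⊗[ℂ] W}
    (hT : ∀ k : G.maximalCompact, T ∘ₗ ρK.tprod σK k = ρK.tprod σK k ∘ₗ T)
    (hR : ∀ k : G.maximalCompact, R ∘ₗ ρK.tprod σK k = ρK.tprod σK k ∘ₗ R) (k : G.maximalCompact) :
    (T - R) ∘ₗ ρK.tprod σK k = ρK.tprod σK k ∘ₗ (T - R) := by
  rw [LinearMap.sub_comp, LinearMap.comp_sub, hT k, hR k]

omit [StarModule ℝ A] in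
/-- The mixed operator as a difference: `M = T₁ - C_V ⊗ 1`. [folklore] -/
theorem mixed_eq_sub :
    mixed G ρ𝔤 y y' σ𝔤 = (∑ s, (ρ𝔤 (y s)).rTensor W * GKTensor.lie G ρ𝔤 σ𝔤 (y' s)) -
      (GKCasimir.op G ρ𝔤 y y').rTensor W := by
  rw [sum_rTensor_mul_lie, add_sub_cancel_left]

omit [StarModule ℝ A] in
/-- `M` commutes with `𝔤`. [folklore] -/
theorem mixed_comm𝔤
    (hT : ∀ X : G.lie, ∑ s, (⁅X, y s⁆ ⊗ₜ[ℝ] y' s + y s ⊗ₜ[ℝ] ⁅X, y' s⁆) = (0 : G.lie ⊗[ℝ] G.lie))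
    (X : G.lie) :
    mixed G ρ𝔤 y y' σ𝔤 ∘ₗ GKTensor.lie G ρ𝔤 σ𝔤 X = GKTensor.lie G ρ𝔤 σ𝔤 X ∘ₗ mixed G ρ𝔤 y y' σ𝔤 := by
  rw [mixed_eq_sub]
  exact sub_comm𝔤 G ρ𝔤 σ𝔤 (sum_rTensor_mul_lie_comm𝔤 G ρ𝔤 y y' σ𝔤 hT)
    (rTensor_comm_lie G ρ𝔤 σ𝔤 _ (GKCasimir.op_comm𝔤 G ρ𝔤 y y' hT)) X

omit [StarModule ℝ A] in
include hV hW in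
/-- `M` commutes with `K`. [folklore] -/
theorem mixed_commK
    (hTK : ∀ k : G.maximalCompact,
      ∑ s, G.Ad (Subgroup.inclusion G.maximalCompact_le_carrier k) (y s) ⊗ₜ[ℝ]
          G.Ad (Subgroup.inclusion G.maximalCompact_le_carrier k) (y' s) = ∑ s, y s ⊗ₜ[ℝ] y' s)
    (k : G.maximalCompact) :
    mixed G ρ𝔤 y y' σ𝔤 ∘ₗ ρK.tprod σK k = ρK.tprod σK k ∘ₗ mixed G ρ𝔤 y y' σ𝔤 := by
  rw [mixed_eq_sub]
  exact sub_commK G ρK σK (sum_rTensor_mul_lie_commK G ρK ρ𝔤 hV y y' σK σ𝔤 hW hTK)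
    (rTensor_comm_tprod G ρK σK _ (GKCasimir.op_commK G ρK ρ𝔤 hV y y' hTK)) k

/-- Congruence of `endoCohomologyHom` in the operator. [folklore] -/
theorem endoCohomologyHom_congr {T T' : V ⊗[ℂ] W →ₗ[ℂ] V ⊗[ℂ] W} (h : T = T') (hT𝔤 hTK hT'𝔤 hT'K)
    (q : ℕ) :
    endoCohomologyHom G ρK ρ𝔤 hV σK σ𝔤 hW T hT𝔤 hTK q =
      endoCohomologyHom G ρK ρ𝔤 hV σK σ𝔤 hW T' hT'𝔤 hT'K q := by
  subst h; rfl

/-- Additivity of `endoCohomologyHom`. [cite: BorelWallach2000, I §1.2] -/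
theorem endoCohomologyHom_add (T₁ T₂ : V ⊗[ℂ] W →ₗ[ℂ] V ⊗[ℂ] W) (h₁𝔤 h₁K h₂𝔤 h₂K h𝔤 hK) (q : ℕ)
    (x : GKTensor.cohomology G ρK ρ𝔤 σK σ𝔤 hV hW q) :
    endoCohomologyHom G ρK ρ𝔤 hV σK σ𝔤 hW (T₁ + T₂) h𝔤 hK q x =
      endoCohomologyHom G ρK ρ𝔤 hV σK σ𝔤 hW T₁ h₁𝔤 h₁K q x +
        endoCohomologyHom G ρK ρ𝔤 hV σK σ𝔤 hW T₂ h₂𝔤 h₂K q x :=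
  gkCohomologyHom_add G _ _ _ _ _ _ T₁ T₂ h₁𝔤 h₁K h₂𝔤 h₂K h𝔤 hK q x

/-- `endoCohomologyHom` of a scalar is the scalar. [folklore] -/
theorem endoCohomologyHom_eq_smul {T : V ⊗[ℂ] W →ₗ[ℂ] V ⊗[ℂ] W} (hT𝔤 hTK) {c : ℂ}
    (h : T = c • LinearMap.id) (q : ℕ) (x : GKTensor.cohomology G ρK ρ𝔤 σK σ𝔤 hV hW q) :
    endoCohomologyHom G ρK ρ𝔤 hV σK σ𝔤 hW T hT𝔤 hTK q x = c • x := by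
  subst h
  change gkCohomologyHom G _ _ _ _ _ _ (c • LinearMap.id) hT𝔤 hTK q x = c • x
  rw [gkCohomologyHom_smul_left G _ _ _ _ _ _ c LinearMap.id (fun _ => rfl) (fun _ => rfl) hT𝔤 hTK q x,
    gkCohomologyHom_id]

/-- **Wigner's lemma for quadratic Casimir operators, cohomological form.** For `(𝔤, K)`-module
data `V`, `W` and a finite family `(y_s, y'_s)` in `𝔤` whose tensor `∑ y_s ⊗ y'_s` is symmetric,
`𝔤`-invariant and `Ad(K)`-invariant (e.g. the canonical tensor of an `Ad`-invariant
non-degenerate symmetric form), the Casimir operators `C_V = ∑ ρ𝔤(y_s)ρ𝔤(y'_s)` and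
`C_W = ∑ σ𝔤(y_s)σ𝔤(y'_s)` induce THE SAME endomorphism of `H^q(𝔤, K; V ⊗ W)`:
`H(C_V ⊗ 1) = H(1 ⊗ C_W)` (both equal `-H(M)`, `M = ∑ ρ𝔤(y_s) ⊗ σ𝔤(y'_s)`, since
`C_V ⊗ 1 + M` and `M + 1 ⊗ C_W` are null-homotopic by the Casimir homotopies with
`σ = ρ𝔤 ⊗ 1`, `1 ⊗ σ𝔤`). This is the mechanism of [cite: BorelWallach2000, I §4.1, Thm. 4.1]
(Wigner's lemma, there via `Ext`) for the quadratic part of the centre.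
[cite: ChevalleyEilenberg1948, §24] -/
theorem endoCohomologyHom_rTensor_op_eq_lTensor_op
    (hT : ∀ X : G.lie, ∑ s, (⁅X, y s⁆ ⊗ₜ[ℝ] y' s + y s ⊗ₜ[ℝ] ⁅X, y' s⁆) = (0 : G.lie ⊗[ℝ] G.lie))
    (hTK : ∀ k : G.maximalCompact,
      ∑ s, G.Ad (Subgroup.inclusion G.maximalCompact_le_carrier k) (y s) ⊗ₜ[ℝ]
          G.Ad (Subgroup.inclusion G.maximalCompact_le_carrier k) (y' s) = ∑ s, y s ⊗ₜ[ℝ] y' s)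
    (hTs : ∑ s, y' s ⊗ₜ[ℝ] y s = ∑ s, y s ⊗ₜ[ℝ] y' s)
    (q : ℕ) (x : GKTensor.cohomology G ρK ρ𝔤 σK σ𝔤 hV hW q) :
    endoCohomologyHom G ρK ρ𝔤 hV σK σ𝔤 hW ((GKCasimir.op G ρ𝔤 y y').rTensor W)
        (rTensor_comm_lie G ρ𝔤 σ𝔤 _ (GKCasimir.op_comm𝔤 G ρ𝔤 y y' hT))
        (rTensor_comm_tprod G ρK σK _ (GKCasimir.op_commK G ρK ρ𝔤 hV y y' hTK)) q x =
      endoCohomologyHom G ρK ρ𝔤 hV σK σ𝔤 hW ((GKCasimir.op G σ𝔤 y y').lTensor V)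
        (lTensor_comm_lie G ρ𝔤 σ𝔤 _ (GKCasimir.op_comm𝔤 G σ𝔤 y y' hT))
        (lTensor_comm_tprod G ρK σK _ (GKCasimir.op_commK G σK σ𝔤 hW y y' hTK)) q x := by
  -- `H(T₁) x = 0 = H(T₂) x`
  have h1 := endoCohomologyHom_sum_rTensor_mul_lie_eq_zero G ρK ρ𝔤 hV y y' σK σ𝔤 hW hT hTK
    (sum_rTensor_mul_lie_comm𝔤 G ρ𝔤 y y' σ𝔤 hT)
    (sum_rTensor_mul_lie_commK G ρK ρ𝔤 hV y y' σK σ𝔤 hW hTK) q x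
  have h2 := endoCohomologyHom_sum_lTensor_mul_lie_eq_zero G ρK ρ𝔤 hV y y' σK σ𝔤 hW hT hTK
    (sum_lTensor_mul_lie_comm𝔤 G ρ𝔤 y y' σ𝔤 hT)
    (sum_lTensor_mul_lie_commK G ρK ρ𝔤 hV y y' σK σ𝔤 hW hTK) q x
  -- rewrite `T₁ = C_V ⊗ 1 + M`, `T₂ = M + 1 ⊗ C_W`
  have e1 : (∑ s, (ρ𝔤 (y s)).rTensor W * GKTensor.lie G ρ𝔤 σ𝔤 (y' s)) =
      (GKCasimir.op G ρ𝔤 y y').rTensor W + mixed G ρ𝔤 y y' σ𝔤 := sum_rTensor_mul_lie G ρ𝔤 y y' σ𝔤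
  have e2 : (∑ s, (σ𝔤 (y s)).lTensor V * GKTensor.lie G ρ𝔤 σ𝔤 (y' s)) =
      mixed G ρ𝔤 y y' σ𝔤 + (GKCasimir.op G σ𝔤 y y').lTensor V := by
    rw [sum_lTensor_mul_lie, mixed_swap G ρ𝔤 y y' σ𝔤 hTs]
  have hM𝔤 := mixed_comm𝔤 G ρ𝔤 y y' σ𝔤 hT
  have hMK := mixed_commK G ρK ρ𝔤 hV y y' σK σ𝔤 hW hTK
  have hC𝔤 := rTensor_comm_lie G ρ𝔤 σ𝔤 (W := W) _ (GKCasimir.op_comm𝔤 G ρ𝔤 y y' hT)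
  have hCK := rTensor_comm_tprod G ρK σK (W := W) _ (GKCasimir.op_commK G ρK ρ𝔤 hV y y' hTK)
  have hD𝔤 := lTensor_comm_lie G ρ𝔤 σ𝔤 (V := V) _ (GKCasimir.op_comm𝔤 G σ𝔤 y y' hT)
  have hDK := lTensor_comm_tprod G ρK σK (V := V) _ (GKCasimir.op_commK G σK σ𝔤 hW y y' hTK)
  rw [endoCohomologyHom_congr G ρK ρ𝔤 hV σK σ𝔤 hW e1 _ _
      (fun X => by rw [← e1]; exact sum_rTensor_mul_lie_comm𝔤 G ρ𝔤 y y' σ𝔤 hT X)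
      (fun k => by rw [← e1]; exact sum_rTensor_mul_lie_commK G ρK ρ𝔤 hV y y' σK σ𝔤 hW hTK k) q,
    endoCohomologyHom_add G ρK ρ𝔤 hV σK σ𝔤 hW _ _ hC𝔤 hCK hM𝔤 hMK] at h1
  rw [endoCohomologyHom_congr G ρK ρ𝔤 hV σK σ𝔤 hW e2 _ _
      (fun X => by rw [← e2]; exact sum_lTensor_mul_lie_comm𝔤 G ρ𝔤 y y' σ𝔤 hT X)
      (fun k => by rw [← e2]; exact sum_lTensor_mul_lie_commK G ρK ρ𝔤 hV y y' σK σ𝔤 hW hTK k) q,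
    endoCohomologyHom_add G ρK ρ𝔤 hV σK σ𝔤 hW _ _ hM𝔤 hMK hD𝔤 hDK] at h2
  -- `a + m = 0`, `m + b = 0` ⇒ `a = b`
  have h3 := h1.trans h2.symm
  rwa [add_comm (endoCohomologyHom G ρK ρ𝔤 hV σK σ𝔤 hW (mixed G ρ𝔤 y y' σ𝔤) hM𝔤 hMK q x),
    add_right_cancel_iff] at h3

/-- **Wigner's lemma for quadratic Casimir operators, scalar form.** If moreover `C_V` acts on
`V` by the scalar `c` and `C_W` on `W` by the scalar `c'`, and `H^q(𝔤, K; V ⊗ W) ≠ 0`, then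
`c = c'`. [cite: BorelWallach2000, I §4.1, Thm. 4.1] [cite: ChevalleyEilenberg1948, §24] -/
theorem casimir_scalar_eq_of_cohomology_ne_zero
    (hT : ∀ X : G.lie, ∑ s, (⁅X, y s⁆ ⊗ₜ[ℝ] y' s + y s ⊗ₜ[ℝ] ⁅X, y' s⁆) = (0 : G.lie ⊗[ℝ] G.lie))
    (hTK : ∀ k : G.maximalCompact,
      ∑ s, G.Ad (Subgroup.inclusion G.maximalCompact_le_carrier k) (y s) ⊗ₜ[ℝ]
          G.Ad (Subgroup.inclusion G.maximalCompact_le_carrier k) (y' s) = ∑ s, y s ⊗ₜ[ℝ] y' s)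
    (hTs : ∑ s, y' s ⊗ₜ[ℝ] y s = ∑ s, y s ⊗ₜ[ℝ] y' s) {c c' : ℂ}
    (hc : ∀ v : V, GKCasimir.op G ρ𝔤 y y' v = c • v)
    (hc' : ∀ w : W, GKCasimir.op G σ𝔤 y y' w = c' • w) (q : ℕ)
    (hx : ∃ x : GKTensor.cohomology G ρK ρ𝔤 σK σ𝔤 hV hW q, x ≠ 0) : c = c' := by
  obtain ⟨x, hx⟩ := hx
  have h := endoCohomologyHom_rTensor_op_eq_lTensor_op G ρK ρ𝔤 hV y y' σK σ𝔤 hW hT hTK hTs q x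
  have e1 : (GKCasimir.op G ρ𝔤 y y').rTensor W = c • LinearMap.id := by
    rw [show GKCasimir.op G ρ𝔤 y y' = c • LinearMap.id from LinearMap.ext fun v => hc v,
      LinearMap.rTensor_smul, LinearMap.rTensor_id]
  have e2 : (GKCasimir.op G σ𝔤 y y').lTensor V = c' • LinearMap.id := by
    rw [show GKCasimir.op G σ𝔤 y y' = c' • LinearMap.id from LinearMap.ext fun w => hc' w,
      LinearMap.lTensor_smul, LinearMap.lTensor_id]
  rw [endoCohomologyHom_eq_smul G ρK ρ𝔤 hV σK σ𝔤 hW _ _ e1,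
    endoCohomologyHom_eq_smul G ρK ρ𝔤 hV σK σ𝔤 hW _ _ e2, ← sub_eq_zero, ← sub_smul,
    smul_eq_zero] at h
  exact sub_eq_zero.mp (h.resolve_right hx)

/-- **Central elements, scalar form.** If `Z ∈ 𝔤` is central and `Ad(K)`-fixed, acts on `V` by
`c` and on `W` by `c'`, and `H^q(𝔤, K; V ⊗ W) ≠ 0`, then `c + c' = 0` (`Z` acts on `V ⊗ W` by
`c + c'` and by zero on cohomology). [cite: BorelWallach2000, I §1.1 (5), §4.1] -/
theorem central_scalar_add_eq_zero_of_cohomology_ne_zero {Z : G.lie} (hZ : ∀ X : G.lie, ⁅Z, X⁆ = 0)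
    (hZK : ∀ k : G.maximalCompact, G.Ad (Subgroup.inclusion G.maximalCompact_le_carrier k) Z = Z)
    {c c' : ℂ} (hc : ∀ v : V, ρ𝔤 Z v = c • v) (hc' : ∀ w : W, σ𝔤 Z w = c' • w) (q : ℕ)
    (hx : ∃ x : GKTensor.cohomology G ρK ρ𝔤 σK σ𝔤 hV hW q, x ≠ 0) : c + c' = 0 := by
  obtain ⟨x, hx⟩ := hx
  have h := GKCasimir.gkCohomologyMap_central_eq_zero G (ρK.tprod σK) (GKTensor.lie G ρ𝔤 σ𝔤)
    (GKTensor.ad_compat G ρK ρ𝔤 σK σ𝔤 hV hW) hZ hZK q x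
  have e : GKTensor.lie G ρ𝔤 σ𝔤 Z = (c + c') • LinearMap.id := by
    rw [GKTensor.lie_apply, show ρ𝔤 Z = c • LinearMap.id from LinearMap.ext fun v => hc v,
      show σ𝔤 Z = c' • LinearMap.id from LinearMap.ext fun w => hc' w, LinearMap.rTensor_smul,
      LinearMap.rTensor_id, LinearMap.lTensor_smul, LinearMap.lTensor_id, add_smul]
  change endoCohomologyHom G ρK ρ𝔤 hV σK σ𝔤 hW (GKTensor.lie G ρ𝔤 σ𝔤 Z) _ _ q x = 0 at h
  rw [endoCohomologyHom_eq_smul G ρK ρ𝔤 hV σK σ𝔤 hW _ _ e, smul_eq_zero] at h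
  exact h.resolve_right hx

end GKTensor

end Literature.NumberTheory.Automorphic

end
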